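import Mathlib
import Literature.Analysis.FluidPDE.CheskidovFriedlander2009.FluxRatioBound
import Literature.Analysis.FluidPDE.CheskidovFriedlander2009.SteadyStateZerothLaw
import HarnessLib

/-!
# Cheskidov–Friedlander 2009, §3: the perturbation energy identity (3.7) and the quadratic-form
# estimate (3.8)–(3.10), pointwise in time

Cheskidov–Friedlander, Physica D 238 (2009) 783–787 = arXiv:0810.3718v1, proof of Thm. 3.4
(pp. 7–9), the ALGEBRAIC half, in the original variables `a = α + b` (`α` a fixed point of the
viscous model (3.1) with force `f₀e₀`, `b` the perturbation; the paper works with the rescaled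
`B_j = 2^{cj/3}b_j`, `A_j`):

* `sum_sub_mul_rhs_sub` — (3.6)–(3.7): for ANY sequences `α, b` and every `k`,
  `Σ_{j≤k} b_j (rhs_j(α+b) − rhs_j(α)) = −νΣ_{j≤k}2^{2j}b_j² − Σ_{j≤k}2^{cj}α_{j+1}b_j²
   + Σ_{j<k}2^{cj}α_jb_jb_{j+1} − 2^{ck}α_kb_kb_{k+1} − 2^{ck}b_k²b_{k+1}` (the force cancels);
* `cross_term_le`, `quadForm_le` — (3.8)–(3.10): by "completing the square"
  (`2^{cj}√(2^cα_{j+1}α_{j+2})|b_jb_{j+1}| ≤ ½(2^{cj}α_{j+1}b_j² + 2^{c(j+1)}α_{j+2}b²_{j+1})`) and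
  the coefficient bound of Lemma 2.4 (`FluxRatioBound.lean`:
  `2^{cj}(α_j − √(2^cα_{j+1}α_{j+2})) < (1 − γ)ν2^{2j+1}`) plus Cauchy–Schwarz,
  `Σ_{j<k}2^{cj}α_jb_jb_{j+1} − Σ_{j≤k}2^{cj}α_{j+1}b_j² ≤ (1 − γ)νΣ_{j≤k}2^{2j}b_j²`;
* `IsFixedPoint.perturbation_sum_le` — hence, for a positive fixed point and `a = α + b ≥ 0`,
  `Σ_{j≤k} b_j(rhs_j(a) − rhs_j(α)) ≤ −γνΣ_{j≤k}2^{2j}b_j² + 2^{ck}α_{k+1}a_k² + 2^{ck}α_ka_ka_{k+1}`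
  — the boundary term `−2^{ck}a_kb_kb_{k+1}` of (3.7) split as
  `−2^{ck}a_k²a_{k+1} − 2^{ck}α_kα_{k+1}a_k (≤ 0, positivity of `a`) + 2^{ck}α_{k+1}a_k² + 2^{ck}α_ka_ka_{k+1}`;
* `IsFixedPoint.perturbation_sum_le'` — and the two surviving boundary terms are at most
  `2α⁰₀ρ^k(2^{2k}a_k² + 2^{2(k+1)}a²_{k+1})` with `ρ = 2^c2^{−c/3}/4 < 1` (`c < 3`), using the
  uniform bound `α_j < (4/3)α⁰_j` of `SteadyStateZerothLaw.lean` — so that they disappear as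
  `k → ∞` against the time-integrable `H¹` norm (this replaces the paper's appeal to the
  super-exponential decay of `A_j` and dominated convergence, p. 8).

The time integration, the limit `k → ∞` and the Gronwall step ((3.11)–(3.12)) are left to the
discharge of `CheskidovFriedlander2009_globalAttractor` (`GlobalAttractor.lean`).

## References
* [CheskidovFriedlander2009] A. Cheskidov, S. Friedlander, The vanishing viscosity limit for a
  dyadic model, Physica D 238 (2009) 783–787, Thm 3.4, (3.5)–(3.10) pp. 7–8.
-/

noncomputable section

open Set Filter Finset

namespace Literature.Analysis.FluidPDE.CheskidovFriedlander2009

/-! ### (3.6)–(3.7): the algebraic identity -/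

/-- **(3.7) in the original variables**: for any `α, b : ℕ → ℝ` and every `k`,
`Σ_{j≤k} b_j (rhs_j(α + b) − rhs_j(α)) = −νΣ_{j≤k}2^{2j}b_j² − Σ_{j≤k}2^{cj}α_{j+1}b_j²
 + Σ_{j<k}2^{cj}α_jb_jb_{j+1} − 2^{ck}α_kb_kb_{k+1} − 2^{ck}b_k²b_{k+1}`.
[cite: CheskidovFriedlander2009, Thm 3.4 (3.6)–(3.7) p.7–8] -/
theorem sum_sub_mul_rhs_sub (c ν : ℝ) (f α b : ℕ → ℝ) (k : ℕ) :
    ∑ j ∈ range (k + 1), b j * (rhs c ν f (fun i => α i + b i) j - rhs c ν f α j) =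
      -ν * ∑ j ∈ range (k + 1), (2 : ℝ) ^ (2 * j) * b j ^ 2
        - ∑ j ∈ range (k + 1), ((2 : ℝ) ^ c) ^ j * α (j + 1) * b j ^ 2
        + ∑ j ∈ range k, ((2 : ℝ) ^ c) ^ j * α j * b j * b (j + 1)
        - ((2 : ℝ) ^ c) ^ k * α k * b k * b (k + 1) - ((2 : ℝ) ^ c) ^ k * b k ^ 2 * b (k + 1) := by
  induction k with
  | zero =>
    simp only [zero_add, sum_range_one, sum_range_zero, rhs, pow_zero, one_mul, mul_zero]
    ring
  | succ k ih =>
    rw [sum_range_succ, ih, sum_range_succ _ (k + 1), sum_range_succ _ (k + 1),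
      sum_range_succ (fun j => ((2 : ℝ) ^ c) ^ j * α j * b j * b (j + 1)) k]
    simp only [rhs, show k + 1 + 1 = k + 2 from rfl]
    ring

/-! ### (3.8)–(3.10): the quadratic form -/

/-- **One cross term** ("completing the square" (3.8) + the coefficient bound (3.9)–(3.10) +
Cauchy–Schwarz): if `p ≥ 0`, `α_j ≥ 0`, `α_{j+1} > 0`, `α_{j+2} ≥ 0`,
`p^jα_j − p^j√(pα_{j+1}α_{j+2}) ≤ θ2^{2j+1}` with `θ ≥ 0`, then for all `b_j, b_{j+1}`:
`p^jα_jb_jb_{j+1} ≤ ½(p^jα_{j+1}b_j² + p^{j+1}α_{j+2}b²_{j+1}) + ½θ(2^{2j}b_j² + 2^{2(j+1)}b²_{j+1})`.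
[cite: CheskidovFriedlander2009, Thm 3.4 (3.8)–(3.10) p.8] -/
theorem cross_term_le {p θ : ℝ} {α : ℕ → ℝ} (hp : 0 ≤ p) (hθ : 0 ≤ θ) (j : ℕ) (hα0 : 0 ≤ α j)
    (hα1 : 0 < α (j + 1)) (hα2 : 0 ≤ α (j + 2))
    (hcoef : p ^ j * α j - p ^ j * Real.sqrt (p * α (j + 1) * α (j + 2)) ≤ θ * 2 ^ (2 * j + 1))
    (x y : ℝ) :
    p ^ j * α j * x * y ≤
      (p ^ j * α (j + 1) * x ^ 2 + p ^ (j + 1) * α (j + 2) * y ^ 2) / 2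
        + θ * ((2 : ℝ) ^ (2 * j) * x ^ 2 + (2 : ℝ) ^ (2 * (j + 1)) * y ^ 2) / 2 := by
  set R : ℝ := Real.sqrt (p * α (j + 1) * α (j + 2)) with hR
  have hR0 : 0 ≤ R := Real.sqrt_nonneg _
  have hR2 : R ^ 2 = p * α (j + 1) * α (j + 2) := Real.sq_sqrt (by positivity)
  set u : ℝ := |x| with hu
  set v : ℝ := |y| with hv
  have hu0 : 0 ≤ u := abs_nonneg _
  have hv0 : 0 ≤ v := abs_nonneg _
  have hu2 : u ^ 2 = x ^ 2 := sq_abs _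
  have hv2 : v ^ 2 = y ^ 2 := sq_abs _
  have hxy : x * y ≤ u * v := by
    rw [hu, hv, ← abs_mul]
    exact le_abs_self _
  have hpj : 0 ≤ p ^ j * α j := by positivity
  -- step 1: `p^jα_j xy ≤ p^jα_j uv = p^jR uv + (p^jα_j − p^jR) uv ≤ p^jR uv + θ2^{2j+1} uv`
  have h1 : p ^ j * α j * x * y ≤ p ^ j * R * (u * v) + θ * 2 ^ (2 * j + 1) * (u * v) := by
    have := mul_le_mul_of_nonneg_left hxy hpj
    have := mul_le_mul_of_nonneg_right hcoef (mul_nonneg hu0 hv0)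
    nlinarith
  -- step 2: `2p^jR uv ≤ p^jα_{j+1}u² + p^{j+1}α_{j+2}v²` (complete the square, times `α_{j+1} > 0`)
  have h2 : 2 * (p ^ j * R * (u * v)) ≤ p ^ j * α (j + 1) * x ^ 2 + p ^ (j + 1) * α (j + 2) * y ^ 2 := by
    have key : α (j + 1) * (p ^ j * α (j + 1) * u ^ 2 + p ^ j * p * α (j + 2) * v ^ 2
        - 2 * (p ^ j * R * (u * v))) = p ^ j * (α (j + 1) * u - R * v) ^ 2 := by
      linear_combination (-(p ^ j * v ^ 2)) * hR2
    have hnn : 0 ≤ p ^ j * α (j + 1) * u ^ 2 + p ^ j * p * α (j + 2) * v ^ 2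
        - 2 * (p ^ j * R * (u * v)) := by
      rw [← mul_nonneg_iff_of_pos_left hα1, key]
      positivity
    rw [← hu2, ← hv2, pow_succ p j]
    linarith
  -- step 3: `2·2^{2j+1} uv ≤ 2^{2j}u² + 2^{2(j+1)}v²`
  have h3 : 2 * (2 ^ (2 * j + 1) * (u * v)) ≤ (2 : ℝ) ^ (2 * j) * x ^ 2 + (2 : ℝ) ^ (2 * (j + 1)) * y ^ 2 := by
    have e1 : ((2 : ℝ) ^ j) ^ 2 = (2 : ℝ) ^ (2 * j) := by rw [← pow_mul, mul_comm]
    have e2 : ((2 : ℝ) ^ (j + 1)) ^ 2 = (2 : ℝ) ^ (2 * (j + 1)) := by rw [← pow_mul, mul_comm]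
    have e3 : (2 : ℝ) ^ j * (2 : ℝ) ^ (j + 1) = (2 : ℝ) ^ (2 * j + 1) := by rw [← pow_add]; ring_nf
    rw [← hu2, ← hv2, ← e1, ← e2, ← e3]
    nlinarith [sq_nonneg ((2 : ℝ) ^ j * u - (2 : ℝ) ^ (j + 1) * v)]
  have h4 : θ * 2 ^ (2 * j + 1) * (u * v) ≤
      θ * ((2 : ℝ) ^ (2 * j) * x ^ 2 + (2 : ℝ) ^ (2 * (j + 1)) * y ^ 2) / 2 := by
    have := mul_le_mul_of_nonneg_left h3 hθ
    linarith
  linarith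

/-- **(3.8)–(3.10), summed**: under the hypotheses of `cross_term_le` for all `j < k`
(`α ≥ 0` with `α_{j+1} > 0`), for every `b : ℕ → ℝ`,
`Σ_{j<k}p^jα_jb_jb_{j+1} − Σ_{j≤k}p^jα_{j+1}b_j² ≤ θΣ_{j≤k}2^{2j}b_j²`.
[cite: CheskidovFriedlander2009, Thm 3.4 (3.8)–(3.10) p.8] -/
theorem quadForm_le {p θ : ℝ} {α : ℕ → ℝ} (hp : 0 ≤ p) (hθ : 0 ≤ θ) (hα : ∀ j, 0 < α j)
    (hcoef : ∀ j, p ^ j * α j - p ^ j * Real.sqrt (p * α (j + 1) * α (j + 2)) ≤ θ * 2 ^ (2 * j + 1))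
    (b : ℕ → ℝ) (k : ℕ) :
    ∑ j ∈ range k, p ^ j * α j * b j * b (j + 1)
        - ∑ j ∈ range (k + 1), p ^ j * α (j + 1) * b j ^ 2 ≤
      θ * ∑ j ∈ range (k + 1), (2 : ℝ) ^ (2 * j) * b j ^ 2 := by
  -- termwise bound, summed over `j < k`
  have hsum : ∑ j ∈ range k, p ^ j * α j * b j * b (j + 1) ≤
      ∑ j ∈ range k, ((p ^ j * α (j + 1) * b j ^ 2 + p ^ (j + 1) * α (j + 2) * b (j + 1) ^ 2) / 2
        + θ * ((2 : ℝ) ^ (2 * j) * b j ^ 2 + (2 : ℝ) ^ (2 * (j + 1)) * b (j + 1) ^ 2) / 2) :=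
    sum_le_sum fun j _ => cross_term_le hp hθ j (hα j).le (hα (j + 1)) (hα (j + 2)).le (hcoef j) _ _
  -- the shifted partial sums are dominated by the full ones (non-negative terms)
  set S : ℕ → ℝ := fun j => p ^ j * α (j + 1) * b j ^ 2 with hS
  set D : ℕ → ℝ := fun j => (2 : ℝ) ^ (2 * j) * b j ^ 2 with hD
  have hS0 : ∀ j, 0 ≤ S j := fun j => by
    simp only [hS]
    have := (hα (j + 1)).le
    positivity
  have hD0 : ∀ j, 0 ≤ D j := fun j => by simp only [hD]; positivity
  have hsplit : ∑ j ∈ range k, ((p ^ j * α (j + 1) * b j ^ 2 + p ^ (j + 1) * α (j + 2) * b (j + 1) ^ 2) / 2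
        + θ * ((2 : ℝ) ^ (2 * j) * b j ^ 2 + (2 : ℝ) ^ (2 * (j + 1)) * b (j + 1) ^ 2) / 2) =
      (∑ j ∈ range k, S j + ∑ j ∈ range k, S (j + 1)) / 2
        + θ * (∑ j ∈ range k, D j + ∑ j ∈ range k, D (j + 1)) / 2 := by
    simp only [hS, hD, sum_div, mul_sum, ← sum_add_distrib]
  have hS1 : ∑ j ∈ range k, S j ≤ ∑ j ∈ range (k + 1), S j :=
    sum_le_sum_of_subset_of_nonneg (range_mono (Nat.le_succ k)) fun j _ _ => hS0 j
  have hS2 : ∑ j ∈ range k, S (j + 1) ≤ ∑ j ∈ range (k + 1), S j := by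
    rw [sum_range_succ' S k]
    linarith [hS0 0]
  have hD1 : ∑ j ∈ range k, D j ≤ ∑ j ∈ range (k + 1), D j :=
    sum_le_sum_of_subset_of_nonneg (range_mono (Nat.le_succ k)) fun j _ _ => hD0 j
  have hD2 : ∑ j ∈ range k, D (j + 1) ≤ ∑ j ∈ range (k + 1), D j := by
    rw [sum_range_succ' D k]
    linarith [hD0 0]
  rw [hsplit] at hsum
  have hθ' : θ * (∑ j ∈ range k, D j + ∑ j ∈ range k, D (j + 1)) / 2 ≤
      θ * ∑ j ∈ range (k + 1), D j := by
    have := mul_le_mul_of_nonneg_left (add_le_add hD1 hD2) hθ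
    linarith
  show ∑ j ∈ range k, p ^ j * α j * b j * b (j + 1) - ∑ j ∈ range (k + 1), S j ≤
    θ * ∑ j ∈ range (k + 1), D j
  linarith

/-! ### The pointwise estimate for a fixed point and a non-negative state -/

variable {c ν f₀ : ℝ} {α : ℕ → ℝ}

/-- `ρ = 2^c·2^{−c/3}/4 = 2^{2c/3 − 2} < 1` for `c < 3`: the geometric rate at which the boundary
terms of (3.7) vanish against the `H¹` norm. [cite: CheskidovFriedlander2009, Thm 3.4 p.8] -/
theorem rho_lt_one (hc3 : c < 3) : (2 : ℝ) ^ c * (2 : ℝ) ^ (-(c / 3)) / 4 < 1 := by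
  rw [← Real.rpow_add (by norm_num : (0 : ℝ) < 2), div_lt_one (by norm_num : (0 : ℝ) < 4)]
  calc (2 : ℝ) ^ (c + -(c / 3)) < (2 : ℝ) ^ (2 : ℝ) :=
        Real.rpow_lt_rpow_of_exponent_lt (by norm_num) (by linarith)
    _ = 4 := by norm_num

/-- `ρ ≥ 0`. [cite: CheskidovFriedlander2009, Thm 3.4 p.8] -/
theorem rho_nonneg (c : ℝ) : 0 ≤ (2 : ℝ) ^ c * (2 : ℝ) ^ (-(c / 3)) / 4 := by
  have : 0 < (2 : ℝ) ^ c := Real.rpow_pos_of_pos two_pos _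
  have : 0 < (2 : ℝ) ^ (-(c / 3)) := Real.rpow_pos_of_pos two_pos _
  positivity

/-- **(3.7)–(3.10) combined, with the boundary term split by positivity**: let `α` be a
non-negative `ℓ²` fixed point of the viscous model (`3/2 < c < 3`, `ν > 0`, `f₀ > 0`) and `γ`
the constant of Lemma 2.4 (`exists_gamma_coeff_sub_sqrt_lt`).  Then for every state `x ≥ 0`
(think `x = a(t)`), with `b = x − α`, and every `k`,
`Σ_{j≤k} b_j(rhs_j(x) − rhs_j(α)) ≤ −γνΣ_{j≤k}2^{2j}b_j² + 2^{ck}α_{k+1}x_k² + 2^{ck}α_kx_kx_{k+1}`.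
[cite: CheskidovFriedlander2009, Thm 3.4 (3.7)–(3.10) p.8] -/
theorem IsFixedPoint.perturbation_sum_le (hα : IsFixedPoint c ν (force f₀) α) (hν : 0 < ν)
    (hf : 0 < f₀) (hnn : ∀ j, 0 ≤ α j) {γ : ℝ} (hγ1 : γ < 1)
    (hcoef : ∀ j : ℕ, ((2 : ℝ) ^ c) ^ j * α j -
      ((2 : ℝ) ^ c) ^ j * Real.sqrt ((2 : ℝ) ^ c * α (j + 1) * α (j + 2)) < (1 - γ) * ν * (2 : ℝ) ^ (2 * j + 1))
    {x : ℕ → ℝ} (hx : ∀ j, 0 ≤ x j) (k : ℕ) :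
    ∑ j ∈ range (k + 1), (x j - α j) * (rhs c ν (force f₀) x j - rhs c ν (force f₀) α j) ≤
      -(γ * ν) * ∑ j ∈ range (k + 1), (2 : ℝ) ^ (2 * j) * (x j - α j) ^ 2
        + ((2 : ℝ) ^ c) ^ k * α (k + 1) * x k ^ 2 + ((2 : ℝ) ^ c) ^ k * α k * x k * x (k + 1) := by
  have hpos := hα.pos hf hnn
  have hp : 0 ≤ (2 : ℝ) ^ c := (Real.rpow_pos_of_pos two_pos _).le
  set b : ℕ → ℝ := fun j => x j - α j with hb
  have hxb : x = fun i => α i + b i := by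
    funext i
    simp [hb]
  have hid := sum_sub_mul_rhs_sub c ν (force f₀) α b k
  rw [← hxb] at hid
  have hθ : 0 ≤ (1 - γ) * ν := by nlinarith
  have hq := quadForm_le (p := (2 : ℝ) ^ c) (θ := (1 - γ) * ν) hp hθ hpos
    (fun j => (hcoef j).le) b k
  -- the boundary term: `−p^kα_kb_kb_{k+1} − p^kb_k²b_{k+1} = −p^k x_k b_k b_{k+1}`
  --   `= −p^k x_k²x_{k+1} − p^kα_kα_{k+1}x_k + p^kα_{k+1}x_k² + p^kα_kx_kx_{k+1}`
  have hbd : -(((2 : ℝ) ^ c) ^ k * α k * b k * b (k + 1)) - ((2 : ℝ) ^ c) ^ k * b k ^ 2 * b (k + 1) ≤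
      ((2 : ℝ) ^ c) ^ k * α (k + 1) * x k ^ 2 + ((2 : ℝ) ^ c) ^ k * α k * x k * x (k + 1) := by
    have e : -(((2 : ℝ) ^ c) ^ k * α k * b k * b (k + 1)) - ((2 : ℝ) ^ c) ^ k * b k ^ 2 * b (k + 1) =
        ((2 : ℝ) ^ c) ^ k * α (k + 1) * x k ^ 2 + ((2 : ℝ) ^ c) ^ k * α k * x k * x (k + 1)
          - ((2 : ℝ) ^ c) ^ k * x k ^ 2 * x (k + 1) - ((2 : ℝ) ^ c) ^ k * α k * α (k + 1) * x k := by
      simp only [hb]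
      ring
    rw [e]
    have h1 : 0 ≤ ((2 : ℝ) ^ c) ^ k * x k ^ 2 * x (k + 1) := by
      have := hx (k + 1)
      positivity
    have h2 : 0 ≤ ((2 : ℝ) ^ c) ^ k * α k * α (k + 1) * x k := by
      have := hx k
      have := hnn k
      have := hnn (k + 1)
      positivity
    linarith
  show ∑ j ∈ range (k + 1), b j * (rhs c ν (force f₀) x j - rhs c ν (force f₀) α j) ≤
    -(γ * ν) * ∑ j ∈ range (k + 1), (2 : ℝ) ^ (2 * j) * b j ^ 2
      + ((2 : ℝ) ^ c) ^ k * α (k + 1) * x k ^ 2 + ((2 : ℝ) ^ c) ^ k * α k * x k * x (k + 1)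
  rw [hid]
  nlinarith [hq, hbd]

/-- **The surviving boundary terms are geometrically small against the `H¹` norm**: for a
non-negative `ℓ²` fixed point (`3/2 < c < 3`, `ν > 0`, `f₀ > 0`; so `α_j < (4/3)α⁰_j`,
`α⁰_j = α⁰₀(2^{−c/3})^j`) and any `x : ℕ → ℝ`,
`2^{ck}α_{k+1}x_k² + 2^{ck}α_kx_kx_{k+1} ≤ 2α⁰₀ρ^k(2^{2k}x_k² + 2^{2(k+1)}x²_{k+1})`, `ρ = 2^c2^{−c/3}/4`.
[cite: CheskidovFriedlander2009, Thm 3.4 p.8 (the boundary term of (3.7))] -/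
theorem IsFixedPoint.boundary_le (hα : IsFixedPoint c ν (force f₀) α) (hc : 3 / 2 < c) (hc3 : c < 3)
    (hν : 0 < ν) (hf : 0 < f₀) (hnn : ∀ j, 0 ≤ α j) (x : ℕ → ℝ) (k : ℕ) :
    ((2 : ℝ) ^ c) ^ k * α (k + 1) * x k ^ 2 + ((2 : ℝ) ^ c) ^ k * α k * x k * x (k + 1) ≤
      2 * inviscidFixedPoint c f₀ 0 * ((2 : ℝ) ^ c * (2 : ℝ) ^ (-(c / 3)) / 4) ^ k *
        ((2 : ℝ) ^ (2 * k) * x k ^ 2 + (2 : ℝ) ^ (2 * (k + 1)) * x (k + 1) ^ 2) := by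
  set p : ℝ := (2 : ℝ) ^ c with hp
  set q : ℝ := (2 : ℝ) ^ (-(c / 3)) with hq
  set κ : ℝ := inviscidFixedPoint c f₀ 0 with hκ
  have hp0 : 0 < p := Real.rpow_pos_of_pos two_pos _
  have hq0 : 0 < q := Real.rpow_pos_of_pos two_pos _
  have hq1 : q < 1 := by
    rw [hq]
    exact Real.rpow_lt_one_of_one_lt_of_neg (by norm_num) (by linarith)
  have hκ0 : 0 < κ := inviscidFixedPoint_pos c hf 0
  have hφ : ∀ j, inviscidFixedPoint c f₀ j = κ * q ^ j := fun j => by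
    simp only [hκ, hq, inviscidFixedPoint, pow_zero, mul_one]
  have hαk := hα.apply_lt_inviscidFixedPoint hc hc3 hν hf hnn k
  have hαk1 := hα.apply_lt_inviscidFixedPoint hc hc3 hν hf hnn (k + 1)
  rw [hφ] at hαk hαk1
  -- `4^k ρ^k = (pq)^k`
  have hρ : ((p * q / 4) ^ k : ℝ) * (2 : ℝ) ^ (2 * k) = (p * q) ^ k := by
    rw [pow_mul, show ((2 : ℝ) ^ 2) = 4 by norm_num, ← mul_pow]
    congr 1
    field_simp
  have h4 : (2 : ℝ) ^ (2 * (k + 1)) = 4 * (2 : ℝ) ^ (2 * k) := by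
    rw [show 2 * (k + 1) = 2 * k + 2 by ring, pow_add]
    norm_num
    ring
  have hxk : 0 ≤ x k ^ 2 := sq_nonneg _
  have hxk1 : 0 ≤ x (k + 1) ^ 2 := sq_nonneg _
  have hpk : 0 < p ^ k := pow_pos hp0 k
  have hqk : 0 < q ^ k := pow_pos hq0 k
  -- first term: `p^k α_{k+1} x_k² ≤ (4/3)κ q (pq)^k x_k²`
  have hT1 : p ^ k * α (k + 1) * x k ^ 2 ≤ 4 / 3 * κ * q * (p * q) ^ k * x k ^ 2 := by
    have : p ^ k * α (k + 1) ≤ p ^ k * (4 / 3 * (κ * q ^ (k + 1))) :=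
      mul_le_mul_of_nonneg_left hαk1.le hpk.le
    have e : p ^ k * (4 / 3 * (κ * q ^ (k + 1))) = 4 / 3 * κ * q * (p * q) ^ k := by
      rw [mul_pow, pow_succ]
      ring
    rw [← e]
    exact mul_le_mul_of_nonneg_right this hxk
  -- second term: `p^k α_k x_k x_{k+1} ≤ (4/3)κ (pq)^k (x_k² + x_{k+1}²)/2`
  have hT2 : p ^ k * α k * x k * x (k + 1) ≤ 4 / 3 * κ * (p * q) ^ k * ((x k ^ 2 + x (k + 1) ^ 2) / 2) := by
    have hxx : x k * x (k + 1) ≤ (x k ^ 2 + x (k + 1) ^ 2) / 2 := by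
      nlinarith [sq_nonneg (x k - x (k + 1))]
    have hc1 : 0 ≤ p ^ k * α k := mul_nonneg hpk.le (hnn k)
    have s1 : p ^ k * α k * x k * x (k + 1) ≤ p ^ k * α k * ((x k ^ 2 + x (k + 1) ^ 2) / 2) := by
      rw [mul_assoc (p ^ k * α k)]
      exact mul_le_mul_of_nonneg_left hxx hc1
    have s2 : p ^ k * α k ≤ 4 / 3 * κ * (p * q) ^ k := by
      have := mul_le_mul_of_nonneg_left hαk.le hpk.le
      rw [mul_pow]
      nlinarith
    have s3 := mul_le_mul_of_nonneg_right s2 (by positivity : 0 ≤ (x k ^ 2 + x (k + 1) ^ 2) / 2)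
    linarith
  -- assemble: `(4/3)κ(pq)^k [q x_k² + (x_k² + x_{k+1}²)/2] ≤ 2κ ρ^k (4^k x_k² + 4^{k+1} x_{k+1}²)`
  have hpqk : 0 < (p * q) ^ k := pow_pos (mul_pos hp0 hq0) k
  rw [show 2 * κ * (p * q / 4) ^ k * ((2 : ℝ) ^ (2 * k) * x k ^ 2 + (2 : ℝ) ^ (2 * (k + 1)) * x (k + 1) ^ 2)
      = 2 * κ * ((p * q / 4) ^ k * (2 : ℝ) ^ (2 * k)) * (x k ^ 2 + 4 * x (k + 1) ^ 2) by
    rw [h4]; ring, hρ]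
  nlinarith [mul_nonneg (mul_nonneg hκ0.le hpqk.le) hxk, mul_nonneg (mul_nonneg hκ0.le hpqk.le) hxk1,
    mul_nonneg (mul_nonneg (mul_nonneg hκ0.le hpqk.le) hxk) hq0.le]

/-- **The pointwise perturbation estimate, final form**: with `γ` from Lemma 2.4 and
`ρ = 2^c2^{−c/3}/4`, for every non-negative `ℓ²` fixed point `α` (`3/2 < c < 3`, `ν > 0`,
`f₀ > 0`), every state `x ≥ 0` and every `k`,
`Σ_{j≤k}(x_j − α_j)(rhs_j(x) − rhs_j(α)) ≤ −γνΣ_{j≤k}2^{2j}(x_j − α_j)²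
 + 2α⁰₀ρ^k(2^{2k}x_k² + 2^{2(k+1)}x²_{k+1})`. [cite: CheskidovFriedlander2009, Thm 3.4 (3.7)–(3.10) p.8] -/
theorem IsFixedPoint.perturbation_sum_le' (hα : IsFixedPoint c ν (force f₀) α) (hc : 3 / 2 < c)
    (hc3 : c < 3) (hν : 0 < ν) (hf : 0 < f₀) (hnn : ∀ j, 0 ≤ α j) {γ : ℝ} (hγ1 : γ < 1)
    (hcoef : ∀ j : ℕ, ((2 : ℝ) ^ c) ^ j * α j -
      ((2 : ℝ) ^ c) ^ j * Real.sqrt ((2 : ℝ) ^ c * α (j + 1) * α (j + 2)) < (1 - γ) * ν * (2 : ℝ) ^ (2 * j + 1))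
    {x : ℕ → ℝ} (hx : ∀ j, 0 ≤ x j) (k : ℕ) :
    ∑ j ∈ range (k + 1), (x j - α j) * (rhs c ν (force f₀) x j - rhs c ν (force f₀) α j) ≤
      -(γ * ν) * ∑ j ∈ range (k + 1), (2 : ℝ) ^ (2 * j) * (x j - α j) ^ 2
        + 2 * inviscidFixedPoint c f₀ 0 * ((2 : ℝ) ^ c * (2 : ℝ) ^ (-(c / 3)) / 4) ^ k *
          ((2 : ℝ) ^ (2 * k) * x k ^ 2 + (2 : ℝ) ^ (2 * (k + 1)) * x (k + 1) ^ 2) := by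
  have h1 := hα.perturbation_sum_le hν hf hnn hγ1 hcoef hx k
  have h2 := hα.boundary_le hc hc3 hν hf hnn x k
  linarith

end Literature.Analysis.FluidPDE.CheskidovFriedlander2009

end
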